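import Summits.ABC.ABC.Theses.PadicPrimesW80TwoThirds
import Summits.ABC.StewartYu.YuNinetyW80TwoTransferInt
import Summits.ABC.StewartYu.PadicTwoPack

/-! # Crux `W80Two` (stmt-ABC-19486, route `PadicPrimesW80TwoThirds`, rung A1.M2 = Stewart–Yu 1991) — the
# `2`-adic engine composed with the transfer

`Summits/ABC/ABC/Theorems/PadicPrimesW80TwoThirdsW80Two.lean` — cell `abc-stewartyu` (closer filed by p3-g3).
The Waldschmidt-shape `2`-adic bound for rational primes: the `2`-adic `q = 3` descent machine
(`Summits/ABC/StewartYu/PadicTwo*.lean`, `Descent*ThirdQ.lean`, `PadicW80Par3*`/`Sizes3*`/`Numeric3*` — lit g4,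
p2-g3, p1-g5, p5, p4, p3-g3) delivers the engine `Summit.ABC.StewartYu.TwoSetup.engineTwoW80` (integer generators
`≡ 1 (mod 8)`, cube-Kummer, `C(m) = 6·Cw(m)`), and lit's transfer `YuNinetyW80.two_of_w80Engine_int'`
(`αⱼ = qⱼ²`, `c₅ = 25c₁`) turns it into the crux text.  Everything is [folklore] assembly.
-/

set_option linter.dupNamespace false

namespace Summit.ABC.ABC.Cruxes.W80Two.TwoAdicThird

open Summit.ABC.ABC.Theses.PadicPrimesW80TwoThirds

/-- COMPOSITION: the crux BY NAME — the landed `2`-adic engine fed to lit's transfer. [folklore] -/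
theorem W80Two_of : W80Two :=
  Summit.ABC.StewartYu.YuNinetyW80.two_of_w80Engine_int' Summit.ABC.StewartYu.TwoSetup.engineTwoW80

end Summit.ABC.ABC.Cruxes.W80Two.TwoAdicThird

namespace Summit.ABC.ABC.Theorems

/-- **Item `W80Two` (stmt-ABC-19486)**: the Waldschmidt-shape `2`-adic bound for rational primes,
`ord₂(∏ q^{e_q} − 1) < (c₅·#S)^{#S} · 2² · (log B + log log A)·log log A · ∏ log max(4,q)`. [folklore] -/
theorem padicPrimesW80TwoThirds_w80Two_proof :
    Summit.ABC.ABC.Theses.PadicPrimesW80TwoThirds.W80Two :=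
  Summit.ABC.ABC.Cruxes.W80Two.TwoAdicThird.W80Two_of

end Summit.ABC.ABC.Theorems
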